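import Literature.Topology.FourManifolds.LefschetzHandlebody
import Literature.Geometry.Symplectic.PlanarContactBoundary
import Literature.Geometry.Symplectic.SteinDomain
import Literature.Geometry.Symplectic.SteinDomainDiffeomorph
import HarnessLib

/-!
# Stub `stub_steinRealisation` (NF6) of line `modp-braid-orbits` for crux
`ConvexBisection.AcyclicBisectionExists` (stmt-SmoothPoincare4-10508): the topological half at the
two ends of the sorted word, and the genus-`0` reduction

The registered stub `stub_steinRealisation` is VERBATIM the named Literature fact
`Literature.Geometry.Symplectic.steinRealisation_of_sorted_modelsOnFibred`
(`Literature/Geometry/Symplectic/LefschetzSteinRealisation.lean`; Baykur 2006, proof of Thm. 5.1,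
pp. 13–14, with Akbulut–Ozbagci 2001 Thm. 5 / Loi–Piergallini, Eliashberg 1990, Gay, Giroux 2002):
a SORTED fibred model `ModelsOnFibred M g (P ++ N)` (`P` positive, `N` negative, all classes
non-zero) is realised as `M = W₁ ∪_φ W₂` with `W₁ = X(F; P)` (`IsLefschetzHandlebody g P W₁`), both
pieces compact Stein, and ONE open book on `∂W₁` supporting both induced boundary plane fields with
the same orientation.  That fact is an XL formalisation (PALF ⇒ Stein through Legendrian realisation
and Eliashberg's 2-handles, Gay's compatibility, Giroux's correspondence) and is NOT proved here.

This file records, sorry-free, what IS immediate over the tree's vocabulary — the purely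
topological clauses of the conclusion (the gluing `IsBoundaryGluing b₁ b₂ φ (𝓡 4) M` with all the
instance bookkeeping of `W₁`, `W₂`, and `IsLefschetzHandlebody g P W₁`) at the two ENDS of the
sorted word, where Baykur's splitting `D = D₊ ∪ D₋` of the base puts all critical values on one
side:

* `isLefschetzHandlebody_nil_base` — the base `Base g` itself is the Lefschetz handlebody
  `X(F_{g,1}; [])` of the empty word (no handles: `IsMultiAttachment.self_of_isEmpty`);
* `IsLefschetzLink.prefix` / `IsLefschetzLink.suffix` — what restriction of a link realising
  `P ++ N` to its first `|P|` / last `|N|` handles gives (disjointness, shadows, twistings), and what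
  it does NOT give: the circles stay in the pages `pageDir (|P| + |N|) i` of the long word, not in
  the pages `pageDir |P| i` that `IsLefschetzLink g P` prescribes (see the section docstring: the
  clause `IsLefschetzHandlebody g P W₁` of NF6 is consistent — shadows and twistings are isotopy
  invariants — but is not a restriction; it costs a page-rotating isotopy of the sub-link);
* `topologicalSplit_of_negatives_nil` — if `N = []` (all letters positive: `X₋ = F × D²`), a
  fibred model `M = X ∪_Ψ Base g` of word `P ++ []` IS the splitting `W₁ = X = X(F; P)`,
  `W₂ = Base g = X(F; [])`, `φ = Ψ`;
* `topologicalSplit_of_positives_nil` — if `P = []` (all letters negative: `X₊ = F × D²`), the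
  same model read from the other side, `W₁ = Base g = X(F; [])`, `W₂ = X = X(F; N)`, `φ = Ψ⁻¹`
  (`IsBoundaryGluing.symm'`);
* `topologicalSplit_of_nil` — the two together: for `P = [] ∨ N = []` the topological clauses of
  NF6 hold with, moreover, `W₂ = X(F; N)` a Lefschetz handlebody of the negative word (which NF6
  forgets; in print `W₂ = −X₋ = X(F; N)` as an unoriented manifold);
* `nonempty_diffeomorph_base_of_isLefschetzHandlebody_nil`,
  `isSteinDomain_of_isLefschetzHandlebody_nil` — `X(F; []) ≅ Base g` (uniqueness of
  multi-attachments of no handles), so at the ends the Stein clause for the empty-word piece is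
  exactly "the base is a Stein domain" (transport along the diffeomorphism);
* `word_eq_nil_of_genus_zero`, `topologicalSplit_genus_zero` — in genus `0` the lattice
  `ℤ^{2g} = ℤ⁰` is trivial, so an allowable word is EMPTY and NF6 at `g = 0` is the doubly
  degenerate end `P = N = []`: `M = X ∪_Ψ Base 0` with `X ≅ Base 0` (on paper `B⁴ ∪ B⁴`).

What remains of NF6 at these ends (and is the whole difficulty in general): Stein structures on
`X(F; P)` (Akbulut–Ozbagci Thm. 5) and on `Base g ≅ ♮^{2g} S¹ × B³` (Eliashberg's 1-handlebodies;
NB the flat complex structure of `ℂ² ⊃ Base g` does NOT serve: in the flat region `‖x‖ < 2` the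
boundary `{‖w‖ = 1/2}` of the base is foliated by the complex curves `w = const`, hence Levi-flat,
so it is not the regular maximal level set of a strictly plurisubharmonic function for that `J`),
and the common supporting open book with its two Giroux forms.  Audit of the registered signature at
degenerate data (worker of lead c3, 2026-08-16): no defect found — the statement is orientation-free
(`M`, `W₁`, `W₂` are bare smooth manifolds, a Stein structure may induce either orientation), hence
robust to a GLOBAL flip of the conventions (a)–(c) of `LefschetzBasePages.lean` (which would replace
the printed theorem by its mirror image, equally true); the orientation clause (`α₁ ∧ dα₁` and
`α₂ ∧ dα₂` of the same sign) is print's "`∂X₊ = ∂(−X₋)` as oriented manifolds, both contact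
structures positive", i.e. `M = W₁ ∪ W̄₂`; `OpenBook.IsGirouxForm` for a fixed open book admits
Giroux forms of both orientation classes (never `α` and `−α`), so that clause is needed and
consistent; shadows are read through `H₁(Base g; ℤ)` and twistings are winding numbers, both
isotopy invariants, so the page-direction renumbering of `W₁ = X(F; P)` is harmless for truth.

## References
* R. İ. Baykur, *Kähler decomposition of 4-manifolds*, Algebr. Geom. Topol. 6 (2006), Thm. 5.1,
  proof pp. 12–14. [Baykur2006]
* J. B. Etnyre, T. Fuller, *Realizing 4-manifolds as achiral Lefschetz fibrations*, IMRN 2006, §2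
  and proof of Thm. 1. [EtnyreFuller2006]
-/

noncomputable section

-- the prescribed namespace `Summit.<P>.<Sub>.…` duplicates `SmoothPoincare4` (P = Sub)
set_option linter.dupNamespace false

open scoped Manifold ContDiff Topology

namespace Summit.SmoothPoincare4.SmoothPoincare4.Theorems.AcyclicBisectionExists.ModpBraidOrbits

open Set Function
open Literature.Topology.FourManifolds Literature.Topology.FourManifolds.LefschetzBase
  Literature.Geometry.Symplectic

/-! ### The empty word -/

/-- Every family of attaching maps indexed by the letters of the EMPTY word is (vacuously) a
Lefschetz link realising it. [folklore] -/
theorem isLefschetzLink_nil (g : ℕ)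
    (h : Fin ([] : List ((Fin g ⊕ Fin g → ℤ) × Bool)).length → HandleAttachingMap 3 2 (Base g)) :
    IsLefschetzLink g [] h :=
  ⟨fun i => i.elim0, fun i => i.elim0, fun i => i.elim0, fun i => i.elim0⟩

/-- **The base is the Lefschetz handlebody of the empty word**: `Base g = X(F_{g,1}; [])` — the base
with NO handles attached is a multi-attachment along the empty family
(`HandleAttachingMap.IsMultiAttachment.self_of_isEmpty`). In print: `F × D²`, the total space of the
trivial fibration over the disc. [folklore] -/
theorem isLefschetzHandlebody_nil_base (g : ℕ) : IsLefschetzHandlebody g [] (Base g) := by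
  haveI : IsEmpty (Fin ([] : List ((Fin g ⊕ Fin g → ℤ) × Bool)).length) :=
    inferInstanceAs (IsEmpty (Fin 0))
  exact ⟨fun i => i.elim0, isLefschetzLink_nil g _,
    HandleAttachingMap.IsMultiAttachment.self_of_isEmpty _⟩

/-- In genus `0` the lattice `ℤ^{2g} = (Fin 0 ⊕ Fin 0 → ℤ)` is the zero module, so a word all of
whose classes are non-zero (an allowable word) is empty. [folklore] -/
theorem word_eq_nil_of_genus_zero (l : List ((Fin 0 ⊕ Fin 0 → ℤ) × Bool))
    (hl : ∀ x ∈ l, x.1 ≠ 0) : l = [] := by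
  cases l with
  | nil => rfl
  | cons a t =>
    exfalso
    refine hl a (by simp) ?_
    funext i
    rcases i with i | i <;> exact i.elim0

/-! ### The two sub-links of a link realising a sorted word `P ++ N`

What IS obtainable by restriction, for the record (tractable sub-piece (1) of the brief): the first
`|P|` handles of a Lefschetz link realising `P ++ N` have pairwise disjoint ranges, shadows the
classes of `P` and page twistings the signs of `P` — but their attaching circles lie in the pages of
directions `pageDir (|P| + |N|) i`, `i < |P|`, NOT `pageDir |P| i` as `IsLefschetzLink g P` demands;
likewise the last `|N|` handles lie in the pages `pageDir (|P| + |N|) (|P| + j)`.  So the restricted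
family is NOT literally a Lefschetz link of `P` over the base: producing `IsLefschetzHandlebody g P W₁`
for Baykur's `X₊` needs, besides the re-association of the multi-attachment
(`HandleAttachingMapsAssoc.lean`), an isotopy of the sub-link through the pages of `∂ Base g`
(rotation of the page angle `arg w` off the binding, which is not a symmetry of `Base g ⊂ ℂ²`) and the
invariance of attachments under isotopy of the attaching maps.  Shadows (`shadow`, read through the
homology of the whole base) and page twistings (winding numbers) are invariant under such an
isotopy, so the last clause of NF6 is consistent as registered; it is merely not a restriction. -/

section SubLinks

variable {α : Type*}

/-- The letter of `P ++ N` at the index `Fin.castAdd |N| i` (transported along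
`|P ++ N| = |P| + |N|`) is the `i`-th letter of `P`. [folklore] -/
theorem get_cast_castAdd (P N : List α) (i : Fin P.length) :
    (P ++ N).get (Fin.cast List.length_append.symm (Fin.castAdd N.length i)) = P.get i := by
  simp only [List.get_eq_getElem, Fin.val_cast, Fin.val_castAdd]
  exact List.getElem_append_left i.2

/-- The letter of `P ++ N` at the index `Fin.natAdd |P| j` (transported along
`|P ++ N| = |P| + |N|`) is the `j`-th letter of `N`. [folklore] -/
theorem get_cast_natAdd (P N : List α) (j : Fin N.length) :
    (P ++ N).get (Fin.cast List.length_append.symm (Fin.natAdd P.length j)) = N.get j := by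
  simp only [List.get_eq_getElem, Fin.val_cast, Fin.val_natAdd]
  rw [List.getElem_append_right (by omega)]
  simp

/-- **The positive sub-link of a link realising `P ++ N`.**  The first `|P|` attaching maps
(indices `Fin.castAdd |N| i`) have pairwise disjoint ranges, attaching circles in the pages of
directions `pageDir (P ++ N).length i` (sic: the directions of the LONG word), shadows the classes
of `P` and page twistings the signs of `P`.  [folklore] -/
theorem IsLefschetzLink.prefix {g : ℕ} {P N : List ((Fin g ⊕ Fin g → ℤ) × Bool)}
    {h : Fin (P ++ N).length → HandleAttachingMap 3 2 (Base g)} (hl : IsLefschetzLink g (P ++ N) h) :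
    (Pairwise fun i j : Fin P.length =>
        Disjoint (range (h (Fin.cast List.length_append.symm (Fin.castAdd N.length i))).toFun)
          (range (h (Fin.cast List.length_append.symm (Fin.castAdd N.length j))).toFun)) ∧
      (∀ (i : Fin P.length) θ,
        (h (Fin.cast List.length_append.symm (Fin.castAdd N.length i))).attachingCircle θ ∈
          page g (pageDir (P ++ N).length i)) ∧
      (∀ i : Fin P.length,
        shadow g (h (Fin.cast List.length_append.symm (Fin.castAdd N.length i))).attachingCircle
          (h (Fin.cast List.length_append.symm (Fin.castAdd N.length i))).continuous_attachingCircle =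
          (P.get i).1) ∧
      (∀ i : Fin P.length,
        pageTwisting g (h (Fin.cast List.length_append.symm (Fin.castAdd N.length i))).attachingCircle
          (h (Fin.cast List.length_append.symm (Fin.castAdd N.length i))).attachingFraming =
          if (P.get i).2 then -1 else 1) := by
  refine ⟨fun i j hij => hl.disjoint fun e => hij ?_,
    fun i θ => hl.mem_page (Fin.cast List.length_append.symm (Fin.castAdd N.length i)) θ,
    fun i => ?_, fun i => ?_⟩
  · have := congrArg Fin.val e
    simp only [Fin.val_cast, Fin.val_castAdd] at this
    exact Fin.ext this
  · rw [hl.shadow_eq, get_cast_castAdd]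
  · rw [hl.twisting_eq, get_cast_castAdd]

/-- **The negative sub-link of a link realising `P ++ N`.**  The last `|N|` attaching maps (indices
`Fin.natAdd |P| j`) have pairwise disjoint ranges, attaching circles in the pages of directions
`pageDir (P ++ N).length (|P| + j)`, shadows the classes of `N` and page twistings the signs of `N`.
[folklore] -/
theorem IsLefschetzLink.suffix {g : ℕ} {P N : List ((Fin g ⊕ Fin g → ℤ) × Bool)}
    {h : Fin (P ++ N).length → HandleAttachingMap 3 2 (Base g)} (hl : IsLefschetzLink g (P ++ N) h) :
    (Pairwise fun i j : Fin N.length =>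
        Disjoint (range (h (Fin.cast List.length_append.symm (Fin.natAdd P.length i))).toFun)
          (range (h (Fin.cast List.length_append.symm (Fin.natAdd P.length j))).toFun)) ∧
      (∀ (j : Fin N.length) θ,
        (h (Fin.cast List.length_append.symm (Fin.natAdd P.length j))).attachingCircle θ ∈
          page g (pageDir (P ++ N).length (P.length + j))) ∧
      (∀ j : Fin N.length,
        shadow g (h (Fin.cast List.length_append.symm (Fin.natAdd P.length j))).attachingCircle
          (h (Fin.cast List.length_append.symm (Fin.natAdd P.length j))).continuous_attachingCircle =
          (N.get j).1) ∧
      (∀ j : Fin N.length,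
        pageTwisting g (h (Fin.cast List.length_append.symm (Fin.natAdd P.length j))).attachingCircle
          (h (Fin.cast List.length_append.symm (Fin.natAdd P.length j))).attachingFraming =
          if (N.get j).2 then -1 else 1) := by
  refine ⟨fun i j hij => hl.disjoint fun e => hij ?_,
    fun j θ => hl.mem_page (Fin.cast List.length_append.symm (Fin.natAdd P.length j)) θ,
    fun j => ?_, fun j => ?_⟩
  · have := congrArg Fin.val e
    simp only [Fin.val_cast, Fin.val_natAdd] at this
    exact Fin.ext (by omega)
  · rw [hl.shadow_eq, get_cast_natAdd]
  · rw [hl.twisting_eq, get_cast_natAdd]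

/-- The positive and the negative sub-links of a link realising `P ++ N` are disjoint from each
other as well. [folklore] -/
theorem IsLefschetzLink.disjoint_prefix_suffix {g : ℕ} {P N : List ((Fin g ⊕ Fin g → ℤ) × Bool)}
    {h : Fin (P ++ N).length → HandleAttachingMap 3 2 (Base g)} (hl : IsLefschetzLink g (P ++ N) h)
    (i : Fin P.length) (j : Fin N.length) :
    Disjoint (range (h (Fin.cast List.length_append.symm (Fin.castAdd N.length i))).toFun)
      (range (h (Fin.cast List.length_append.symm (Fin.natAdd P.length j))).toFun) :=
  hl.disjoint fun e => by
    have := congrArg Fin.val e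
    simp only [Fin.val_cast, Fin.val_castAdd, Fin.val_natAdd] at this
    omega

end SubLinks

/-! ### The Lefschetz handlebody of the empty word is the base, up to diffeomorphism -/

/-- **`X(F_{g,1}; []) ≅ Base g`.**  A Lefschetz handlebody of the EMPTY word — a multi-attachment of
no handles to the base — is diffeomorphic to the base (uniqueness of multi-attachments against the
model `IsMultiAttachment.self_of_isEmpty`, `IsMultiAttachment.nonempty_diffeomorph_of_isEmpty`).
In print: the total space of a Lefschetz fibration over `D²` without critical points is `F × D²`.
[folklore] -/
theorem nonempty_diffeomorph_base_of_isLefschetzHandlebody_nil {g : ℕ} {X : Type*}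
    [TopologicalSpace X] [ChartedSpace (EuclideanHalfSpace 4) X] [IsManifold (𝓡∂ 4) ∞ X]
    (hX : IsLefschetzHandlebody g [] X) : Nonempty (X ≃ₘ⟮𝓡∂ 4, 𝓡∂ 4⟯ Base g) := by
  obtain ⟨h, -, hatt⟩ := hX
  haveI : IsEmpty (Fin ([] : List ((Fin g ⊕ Fin g → ℤ) × Bool)).length) :=
    inferInstanceAs (IsEmpty (Fin 0))
  exact hatt.nonempty_diffeomorph_of_isEmpty

/-- **At the ends of the sorted word the Stein clause for `X(F; [])` is Stein-ness of the base.**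
If the base `Base g` is a Stein domain (on paper `F_{g,1} × D² ≅ ♮^{2g} S¹ × B³`, Stein by
Eliashberg's 1-handles — NOT for the flat complex structure of `ℂ²`, whose boundary pieces
`{‖w‖ = 1/2}` are Levi-flat), then so is every Lefschetz handlebody of the empty word (transport of
Stein structures along the diffeomorphism onto the base, `IsSteinDomain.of_diffeomorph`).
[folklore] -/
theorem isSteinDomain_of_isLefschetzHandlebody_nil {g : ℕ} {X : Type*}
    [TopologicalSpace X] [ChartedSpace (EuclideanHalfSpace 4) X] [IsManifold (𝓡∂ 4) ∞ X]
    [CompactSpace X] (hX : IsLefschetzHandlebody g [] X) (hB : IsSteinDomain (Base g)) :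
    IsSteinDomain X := by
  obtain ⟨e⟩ := nonempty_diffeomorph_base_of_isLefschetzHandlebody_nil hX
  exact IsSteinDomain.of_diffeomorph e hB

/-! ### The topological clauses of NF6 at the two ends of the sorted word -/

/-- **NF6, topological half, all letters positive (`N = []`).**  A fibred model
`M = X ∪_Ψ Base g` of the word `P ++ []` is already the splitting of the conclusion of
`steinRealisation_of_sorted_modelsOnFibred`: `W₁ = X = X(F; P)` (its Lefschetz link and
multi-attachment data are those of the model), `W₂ = Base g = X(F; [])` (Baykur's `X₋ = F × D₋²`:
the disc `D₋` contains no critical value), `φ = Ψ`.  [folklore] -/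
theorem topologicalSplit_of_negatives_nil (M : Type) [TopologicalSpace M]
    [ChartedSpace (EuclideanSpace ℝ (Fin 4)) M] (g : ℕ) (P : List ((Fin g ⊕ Fin g → ℤ) × Bool))
    (hM : ModelsOnFibred M g (P ++ [])) :
    ∃ (W₁ : Type) (_ : TopologicalSpace W₁) (_ : ChartedSpace (EuclideanHalfSpace 4) W₁)
      (_ : IsManifold (𝓡∂ 4) ∞ W₁) (_ : CompactSpace W₁) (_ : T2Space W₁)
      (_ : SecondCountableTopology W₁)
      (W₂ : Type) (_ : TopologicalSpace W₂) (_ : ChartedSpace (EuclideanHalfSpace 4) W₂)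
      (_ : IsManifold (𝓡∂ 4) ∞ W₂) (_ : CompactSpace W₂) (_ : T2Space W₂)
      (_ : SecondCountableTopology W₂)
      (b₁ : BoundaryData (𝓡∂ 4) W₁ (𝓡 3)) (b₂ : BoundaryData (𝓡∂ 4) W₂ (𝓡 3))
      (φ : b₁.carrier ≃ₘ⟮𝓡 3, 𝓡 3⟯ b₂.carrier),
      IsBoundaryGluing b₁ b₂ φ (𝓡 4) M ∧ IsLefschetzHandlebody g P W₁ ∧
        IsLefschetzHandlebody g [] W₂ := by
  rw [List.append_nil] at hM
  obtain ⟨X, _, _, _, _, _, _, h, D, bX, Ψ, hlink, hglue, -⟩ := hM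
  exact ⟨X, inferInstance, inferInstance, inferInstance, inferInstance, inferInstance, inferInstance,
    Base g, inferInstance, inferInstance, inferInstance, inferInstance, inferInstance, inferInstance,
    bX, bBase g, Ψ, hglue, ⟨h, hlink, D.isMultiAttachment⟩, isLefschetzHandlebody_nil_base g⟩

/-- **NF6, topological half, all letters negative (`P = []`).**  A fibred model
`M = X ∪_Ψ Base g` of the word `[] ++ N`, read from the other side: `W₁ = Base g = X(F; [])`
(Baykur's `X₊ = F × D₊²`), `W₂ = X = X(F; N)` (Baykur's `X₋`, the achiral handlebody of the
negative word), `φ = Ψ⁻¹` (`M ∪_Ψ N = N ∪_{Ψ⁻¹} M`, `IsBoundaryGluing.symm'`). [folklore] -/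
theorem topologicalSplit_of_positives_nil (M : Type) [TopologicalSpace M]
    [ChartedSpace (EuclideanSpace ℝ (Fin 4)) M] (g : ℕ) (N : List ((Fin g ⊕ Fin g → ℤ) × Bool))
    (hM : ModelsOnFibred M g ([] ++ N)) :
    ∃ (W₁ : Type) (_ : TopologicalSpace W₁) (_ : ChartedSpace (EuclideanHalfSpace 4) W₁)
      (_ : IsManifold (𝓡∂ 4) ∞ W₁) (_ : CompactSpace W₁) (_ : T2Space W₁)
      (_ : SecondCountableTopology W₁)
      (W₂ : Type) (_ : TopologicalSpace W₂) (_ : ChartedSpace (EuclideanHalfSpace 4) W₂)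
      (_ : IsManifold (𝓡∂ 4) ∞ W₂) (_ : CompactSpace W₂) (_ : T2Space W₂)
      (_ : SecondCountableTopology W₂)
      (b₁ : BoundaryData (𝓡∂ 4) W₁ (𝓡 3)) (b₂ : BoundaryData (𝓡∂ 4) W₂ (𝓡 3))
      (φ : b₁.carrier ≃ₘ⟮𝓡 3, 𝓡 3⟯ b₂.carrier),
      IsBoundaryGluing b₁ b₂ φ (𝓡 4) M ∧ IsLefschetzHandlebody g [] W₁ ∧
        IsLefschetzHandlebody g N W₂ := by
  rw [List.nil_append] at hM
  obtain ⟨X, _, _, _, _, _, _, h, D, bX, Ψ, hlink, hglue, -⟩ := hM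
  exact ⟨Base g, inferInstance, inferInstance, inferInstance, inferInstance, inferInstance,
    inferInstance, X, inferInstance, inferInstance, inferInstance, inferInstance, inferInstance,
    inferInstance, bBase g, bX, Ψ.symm, hglue.symm', isLefschetzHandlebody_nil_base g,
    ⟨h, hlink, D.isMultiAttachment⟩⟩

/-- **NF6, topological half at the two ends of the sorted word.**  If `P = []` or `N = []`, a fibred
model of `M` with word `P ++ N` splits `M = W₁ ∪_φ W₂` with `W₁ = X(F; P)` and `W₂ = X(F; N)`, both
compact Hausdorff second-countable `C^∞` 4-manifolds with boundary — the clauses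
`IsBoundaryGluing b₁ b₂ φ (𝓡 4) M` and `IsLefschetzHandlebody g P W₁` of the registered signature of
`stub_steinRealisation` (= `steinRealisation_of_sorted_modelsOnFibred`), plus the clause
`IsLefschetzHandlebody g N W₂` which that fact forgets.  The positivity / negativity / allowability
hypotheses of NF6 are not needed for this half.  What NF6 adds — Stein structures on the two pieces
and one open book on `∂W₁` with Giroux forms for both induced plane fields — is Baykur 2006, proof of
Thm. 5.1 (Akbulut–Ozbagci Thm. 5, Eliashberg, Gay, Giroux) and is not proved here.
[cite: Baykur2006, Thm. 5.1 (proof, pp. 13–14)] -/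
theorem topologicalSplit_of_nil (M : Type) [TopologicalSpace M]
    [ChartedSpace (EuclideanSpace ℝ (Fin 4)) M] (g : ℕ) (P N : List ((Fin g ⊕ Fin g → ℤ) × Bool))
    (hM : ModelsOnFibred M g (P ++ N)) (hend : P = [] ∨ N = []) :
    ∃ (W₁ : Type) (_ : TopologicalSpace W₁) (_ : ChartedSpace (EuclideanHalfSpace 4) W₁)
      (_ : IsManifold (𝓡∂ 4) ∞ W₁) (_ : CompactSpace W₁) (_ : T2Space W₁)
      (_ : SecondCountableTopology W₁)
      (W₂ : Type) (_ : TopologicalSpace W₂) (_ : ChartedSpace (EuclideanHalfSpace 4) W₂)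
      (_ : IsManifold (𝓡∂ 4) ∞ W₂) (_ : CompactSpace W₂) (_ : T2Space W₂)
      (_ : SecondCountableTopology W₂)
      (b₁ : BoundaryData (𝓡∂ 4) W₁ (𝓡 3)) (b₂ : BoundaryData (𝓡∂ 4) W₂ (𝓡 3))
      (φ : b₁.carrier ≃ₘ⟮𝓡 3, 𝓡 3⟯ b₂.carrier),
      IsBoundaryGluing b₁ b₂ φ (𝓡 4) M ∧ IsLefschetzHandlebody g P W₁ ∧
        IsLefschetzHandlebody g N W₂ := by
  rcases hend with rfl | rfl
  · exact topologicalSplit_of_positives_nil M g N hM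
  · exact topologicalSplit_of_negatives_nil M g P hM

/-- **Registered helper stub `stub_steinRealisation_topologicalEnds` (sub-goal of NF6
`stub_steinRealisation`, worker of lead c3): the topological clauses of Baykur's Stein realisation at
the two ends of the sorted word.**  For a fibred model of `M` with word `P ++ N` and `P = []` or
`N = []`: `M = W₁ ∪_φ W₂` (`IsBoundaryGluing`) with `W₁ = X(F; P)` (`IsLefschetzHandlebody g P W₁`, the
last clause of NF6) and `W₂ = X(F; N)`, both compact Hausdorff second-countable `C^∞` 4-manifolds
with boundary (= `topologicalSplit_of_nil`).  [cite: Baykur2006, Thm. 5.1 (proof, pp. 13–14)] -/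
theorem stub_steinRealisation_topologicalEnds :
    ∀ (M : Type) [TopologicalSpace M] [ChartedSpace (EuclideanSpace ℝ (Fin 4)) M] (g : ℕ)
      (P N : List ((Fin g ⊕ Fin g → ℤ) × Bool)),
      ModelsOnFibred M g (P ++ N) → (P = [] ∨ N = []) →
      ∃ (W₁ : Type) (_ : TopologicalSpace W₁) (_ : ChartedSpace (EuclideanHalfSpace 4) W₁)
        (_ : IsManifold (𝓡∂ 4) ∞ W₁) (_ : CompactSpace W₁) (_ : T2Space W₁)
        (_ : SecondCountableTopology W₁)
        (W₂ : Type) (_ : TopologicalSpace W₂) (_ : ChartedSpace (EuclideanHalfSpace 4) W₂)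
        (_ : IsManifold (𝓡∂ 4) ∞ W₂) (_ : CompactSpace W₂) (_ : T2Space W₂)
        (_ : SecondCountableTopology W₂)
        (b₁ : BoundaryData (𝓡∂ 4) W₁ (𝓡 3)) (b₂ : BoundaryData (𝓡∂ 4) W₂ (𝓡 3))
        (φ : b₁.carrier ≃ₘ⟮𝓡 3, 𝓡 3⟯ b₂.carrier),
        IsBoundaryGluing b₁ b₂ φ (𝓡 4) M ∧ IsLefschetzHandlebody g P W₁ ∧
          IsLefschetzHandlebody g N W₂ :=
  fun M _ _ g P N hM hend => topologicalSplit_of_nil M g P N hM hend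

/-- **NF6 in genus `0` is the doubly degenerate end.**  Under the allowability hypothesis of NF6
(`∀ x ∈ P ++ N, x.1 ≠ 0`) a genus-`0` word is empty (`word_eq_nil_of_genus_zero`), so the model is
`M = X ∪_Ψ Base 0` with `X = X(F_{0,1}; []) ≅ Base 0` (on paper `B⁴ ∪_Ψ B⁴`), and the topological
clauses of NF6 hold with `W₁ = X`, `W₂ = Base 0`; `P = []` and `N = []` are returned as well.
[folklore] -/
theorem topologicalSplit_genus_zero (M : Type) [TopologicalSpace M]
    [ChartedSpace (EuclideanSpace ℝ (Fin 4)) M] (P N : List ((Fin 0 ⊕ Fin 0 → ℤ) × Bool))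
    (hM : ModelsOnFibred M 0 (P ++ N)) (hnz : ∀ x ∈ P ++ N, x.1 ≠ 0) :
    P = [] ∧ N = [] ∧
    ∃ (W₁ : Type) (_ : TopologicalSpace W₁) (_ : ChartedSpace (EuclideanHalfSpace 4) W₁)
      (_ : IsManifold (𝓡∂ 4) ∞ W₁) (_ : CompactSpace W₁) (_ : T2Space W₁)
      (_ : SecondCountableTopology W₁)
      (W₂ : Type) (_ : TopologicalSpace W₂) (_ : ChartedSpace (EuclideanHalfSpace 4) W₂)
      (_ : IsManifold (𝓡∂ 4) ∞ W₂) (_ : CompactSpace W₂) (_ : T2Space W₂)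
      (_ : SecondCountableTopology W₂)
      (b₁ : BoundaryData (𝓡∂ 4) W₁ (𝓡 3)) (b₂ : BoundaryData (𝓡∂ 4) W₂ (𝓡 3))
      (φ : b₁.carrier ≃ₘ⟮𝓡 3, 𝓡 3⟯ b₂.carrier),
      IsBoundaryGluing b₁ b₂ φ (𝓡 4) M ∧ IsLefschetzHandlebody 0 P W₁ ∧
        IsLefschetzHandlebody 0 N W₂ := by
  have hPN : P ++ N = [] := word_eq_nil_of_genus_zero (P ++ N) hnz
  obtain ⟨hP, hN⟩ := List.append_eq_nil_iff.1 hPN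
  exact ⟨hP, hN, topologicalSplit_of_nil M 0 P N hM (Or.inl hP)⟩

end Summit.SmoothPoincare4.SmoothPoincare4.Theorems.AcyclicBisectionExists.ModpBraidOrbits

end
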